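import Summits.BirchSwinnertonDyer.BirchSwinnertonDyer.Theorems.PrintCf2SplitBadTwoLineDoubleCosetPlacesMirror
import HarnessLib

/-!
# Crux `PrintCf2.SplitBadTwoRankOneOfFacts` (stmt-BirchSwinnertonDyer-20368), road α v13 — (DC) part 4c:
# PLACES OF THE LAYERS `K_n` ABOVE `w` — `D_w \ Γ_K / κ⁻¹(p^n ℤ_p)` — COORDINATES `κ(σ) mod p^{min(m,n)}` AND STABILISATION FROM LAYER `m` ON

Cell `bsd-print-cf2`, EXTRA WIDTH seat `bsd-line-cf2-p1-w8` g4 (prover-bsd-line-cf2-p1-w8-g4-0); the index bookkeeping for the S3N-FACTFREE limit step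
«(SUR*_n) ∀ n ⟹ (LS↑)» (-w2 g14 memo §4: targets over `K*_∞` are born at a finite layer `K*_n`) in R3's orientation (decomposition group on the LEFT).
`--supports stmt-BirchSwinnertonDyer-20368` (helper, Theses-free). HONEST FRAMING: pure group theory on a `ℤ_p`-line; nothing here closes the crux or a
registered stub; BSD is not proved by any of this; no `sorry`, no new axiom, no fact, no definition.

For a closed `S ≤ Γ_K` with `κ(S) = p^m ℤ_p` (`τ₁ ∈ S` of minimal valuation `m`; e.g. `S = D_w`, `m = m_w`):
* `doubleCoset_mk_kerSubgroup_eq_iff` — COORDINATES over `K_∞`: `S·σ·ker κ = S·σ'·ker κ ↔ p^m ∣ κ σ' − κ σ` (so `S \ Γ_K / ker κ ≅ ℤ_p / p^m`);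
* `doubleCoset_mk_layerSubgroup_eq_iff` — COORDINATES at layer `n`: `S·σ·Γ_n = S·σ'·Γ_n ↔ p^{min(m,n)} ∣ κ σ' − κ σ` (`Γ_n = κ⁻¹(p^n ℤ_p) = Gal(K̄/K_n)`);
* `doubleCoset_mk_layerSubgroup_eq_iff_mk_kerSubgroup_eq` — STABILISATION: for `n ≥ m` the places of `K_∞` above `w` and the places of `K_n` above `w`
  have the SAME index set (no place above `w` splits further in `K_∞/K_m`): every target over `K_∞` is born at layer `m`;
* `finite_doubleCosetQuotient_layerSubgroup`, `natCard_doubleCosetQuotient_layerSubgroup_le` (`≤ p^m` at every layer),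
  `natCard_doubleCosetQuotient_layerSubgroup_eq_of_le` (`= p^m` for `n ≥ m`); line / frame instances for `S = D_w`;
* §4 (appended) `exists_forall_doubleCoset_mk_layerSubgroup_eq_iff` (+ `_of_line`, `_of_frame`, counted form) — UNIFORM stabilisation over a finite
  set `T` of places: one layer `N` beyond which no place above a `T`-place splits (the «separation at a deep layer» of the limit step, -w3 g13 R3a);
  `…_of_line_all` / `finite_doubleCosetQuotient_decomp_layerSubgroup_of_line_all` — the `W`-free forms for EVERY `T` / every `w` (appended).
[cite: NeukirchANT1999, Ch. I §9 p. 54] [cite: Washington1997, §13.1–13.2 (layers of a ℤ_p-extension; decomposition of primes)] [cite: GreenbergVatsal2000, §2 Prop. 2.1]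
-/

noncomputable section

set_option linter.dupNamespace false
set_option autoImplicit false

open scoped Classical

open NumberField IsDedekindDomain Field WeierstrassCurve
open Literature.NumberTheory.EllipticCurves Literature.NumberTheory.EllipticCurves.GreenbergSelmer
open Literature.NumberTheory.GaloisRepresentations
open Summit.BirchSwinnertonDyer.BirchSwinnertonDyer.Theorems.AnomalousLocalTorsion

namespace Summit.BirchSwinnertonDyer.BirchSwinnertonDyer.Theorems.PrintCf2.LineDoubleCoset

/-! ## §1. Coordinates on `S \ Γ_K / ker κ` and `S \ Γ_K / Γ_n` -/

section Coordinates

variable {K : Type} [Field K] [NumberField K] {p : ℕ} [Fact p.Prime] (κ : ZpExtension K p)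

omit [NumberField K] in
/-- Enlarging the right-hand subgroup only merges double cosets: `S·a·L = S·b·L → S·a·L' = S·b·L'` for `L ≤ L'`. [folklore] -/
theorem doubleCoset_mk_eq_of_le (S L L' : Subgroup (absoluteGaloisGroup K)) (hL : L ≤ L') {a b : absoluteGaloisGroup K}
    (h : DoubleCoset.mk S L a = DoubleCoset.mk S L b) : DoubleCoset.mk S L' a = DoubleCoset.mk S L' b := by
  obtain ⟨s, hs, l, hl, hb⟩ := (DoubleCoset.eq S L a b).mp h
  exact (DoubleCoset.eq S L' a b).mpr ⟨s, hs, l, hL hl, hb⟩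

/-- **COORDINATES over `K_∞`**: for a closed `S` with `κ(S) = p^m ℤ_p`, `S·σ·ker κ = S·σ'·ker κ ↔ p^m ∣ κ σ' − κ σ` — the double-coset space
`S \ Γ_K / ker κ` is `ℤ_p / p^m ℤ_p` via `σ ↦ κ σ` (`ker κ` is normal with abelian quotient). [cite: NeukirchANT1999, Ch. I §9 p. 54] [cite: Washington1997, §13.1] -/
theorem doubleCoset_mk_kerSubgroup_eq_iff (S : Subgroup (absoluteGaloisGroup K)) (hS : IsClosed (S : Set (absoluteGaloisGroup K)))
    {τ₁ : absoluteGaloisGroup K} (hτ₁ : τ₁ ∈ S) (hne : κ τ₁ ≠ 1)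
    (hmin : ∀ τ ∈ S, (p : ℤ_[p]) ^ ((κ τ₁).toAdd).valuation ∣ (κ τ).toAdd) (σ σ' : absoluteGaloisGroup K) :
    DoubleCoset.mk S κ.kerSubgroup σ = DoubleCoset.mk S κ.kerSubgroup σ' ↔
      (p : ℤ_[p]) ^ ((κ τ₁).toAdd).valuation ∣ (κ σ').toAdd - (κ σ).toAdd := by
  constructor
  · intro h
    obtain ⟨τ, hτ, l, hl, hσ'⟩ := (DoubleCoset.eq S κ.kerSubgroup σ σ').mp h
    have hκ : (κ σ').toAdd = (κ τ).toAdd + (κ σ).toAdd := by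
      simp only [hσ', map_mul, toAdd_mul, ZpExtension.mem_kerSubgroup.mp hl, toAdd_one, add_zero]
    rw [hκ, add_sub_cancel_right]
    exact hmin τ hτ
  · intro hdvd
    obtain ⟨τ, hτS, hτ⟩ := exists_mem_apply_toAdd_eq_of_dvd κ S hS hτ₁ hne hdvd
    refine (DoubleCoset.eq S κ.kerSubgroup σ σ').mpr ⟨τ, hτS, (τ * σ)⁻¹ * σ', ?_, by group⟩
    rw [ZpExtension.mem_kerSubgroup, map_mul, map_inv, map_mul]
    apply Multiplicative.toAdd.injective
    rw [toAdd_mul, toAdd_inv, toAdd_mul, hτ, toAdd_one]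
    ring

/-- **COORDINATES at layer `n`**: `S·σ·Γ_n = S·σ'·Γ_n ↔ p^{min(m,n)} ∣ κ σ' − κ σ`, `Γ_n = κ⁻¹(p^n ℤ_p) = Gal(K̄/K_n)` — the places of the layer `K_n`
above `w` are `ℤ_p / (p^m ℤ_p + p^n ℤ_p)`. [cite: Washington1997, §13.1–13.2] [cite: NeukirchANT1999, Ch. I §9 p. 54] -/
theorem doubleCoset_mk_layerSubgroup_eq_iff (S : Subgroup (absoluteGaloisGroup K)) (hS : IsClosed (S : Set (absoluteGaloisGroup K)))
    {τ₁ : absoluteGaloisGroup K} (hτ₁ : τ₁ ∈ S) (hne : κ τ₁ ≠ 1)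
    (hmin : ∀ τ ∈ S, (p : ℤ_[p]) ^ ((κ τ₁).toAdd).valuation ∣ (κ τ).toAdd) (n : ℕ) (σ σ' : absoluteGaloisGroup K) :
    DoubleCoset.mk S (κ.layerSubgroup n) σ = DoubleCoset.mk S (κ.layerSubgroup n) σ' ↔
      (p : ℤ_[p]) ^ (min ((κ τ₁).toAdd).valuation n) ∣ (κ σ').toAdd - (κ σ).toAdd := by
  set m : ℕ := ((κ τ₁).toAdd).valuation with hm
  constructor
  · intro h
    obtain ⟨τ, hτ, l, hl, hσ'⟩ := (DoubleCoset.eq S (κ.layerSubgroup n) σ σ').mp h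
    have hκ : (κ σ').toAdd = (κ τ).toAdd + (κ σ).toAdd + (κ l).toAdd := by
      simp only [hσ', map_mul, toAdd_mul]
    rw [hκ, show (κ τ).toAdd + (κ σ).toAdd + (κ l).toAdd - (κ σ).toAdd = (κ τ).toAdd + (κ l).toAdd by ring]
    exact dvd_add ((pow_dvd_pow _ (min_le_left m n)).trans (hmin τ hτ))
      ((pow_dvd_pow _ (min_le_right m n)).trans (ZpExtension.mem_layerSubgroup.mp hl))
  · intro hdvd
    rcases le_total m n with hmn | hnm
    · rw [min_eq_left hmn] at hdvd
      exact doubleCoset_mk_eq_of_le S κ.kerSubgroup (κ.layerSubgroup n) (κ.kerSubgroup_le_layerSubgroup n)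
        ((doubleCoset_mk_kerSubgroup_eq_iff κ S hS hτ₁ hne hmin σ σ').mpr hdvd)
    · rw [min_eq_right hnm] at hdvd
      refine (DoubleCoset.eq S (κ.layerSubgroup n) σ σ').mpr ⟨1, S.one_mem, σ⁻¹ * σ', ?_, by group⟩
      rw [ZpExtension.mem_layerSubgroup, map_mul, map_inv, toAdd_mul, toAdd_inv, ← sub_eq_neg_add]
      exact hdvd

/-- **STABILISATION FROM LAYER `m` ON**: for `n ≥ m` (`κ(S) = p^m ℤ_p`), `S·σ·Γ_n = S·σ'·Γ_n ↔ S·σ·ker κ = S·σ'·ker κ` — the places of `K_n` above `w`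
and the places of `K_∞` above `w` have the SAME index set: no place above `w` splits in `K_∞/K_m`, every place of `K_∞` above `w` is born at layer `m`.
[cite: Washington1997, §13.2] [cite: NeukirchANT1999, Ch. I §9 p. 54] -/
theorem doubleCoset_mk_layerSubgroup_eq_iff_mk_kerSubgroup_eq (S : Subgroup (absoluteGaloisGroup K))
    (hS : IsClosed (S : Set (absoluteGaloisGroup K))) {τ₁ : absoluteGaloisGroup K} (hτ₁ : τ₁ ∈ S) (hne : κ τ₁ ≠ 1)
    (hmin : ∀ τ ∈ S, (p : ℤ_[p]) ^ ((κ τ₁).toAdd).valuation ∣ (κ τ).toAdd) {n : ℕ} (hn : ((κ τ₁).toAdd).valuation ≤ n)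
    (σ σ' : absoluteGaloisGroup K) :
    DoubleCoset.mk S (κ.layerSubgroup n) σ = DoubleCoset.mk S (κ.layerSubgroup n) σ' ↔
      DoubleCoset.mk S κ.kerSubgroup σ = DoubleCoset.mk S κ.kerSubgroup σ' := by
  rw [doubleCoset_mk_layerSubgroup_eq_iff κ S hS hτ₁ hne hmin n σ σ', min_eq_left hn,
    doubleCoset_mk_kerSubgroup_eq_iff κ S hS hτ₁ hne hmin σ σ']

end Coordinates

/-! ## §2. Representatives `γ^a` and counts at every layer -/

section Counts

variable {K : Type} [Field K] [NumberField K] {p : ℕ} [Fact p.Prime] (κ : ZpExtension K p)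

/-- **At every layer the double coset `S·σ·Γ_n` is `S·γ^a·Γ_n` for some `a < p^m`** (from part 4b's decomposition `σ = τ γ^a h`, `h ∈ ker κ ≤ Γ_n`).
[cite: NeukirchANT1999, Ch. I §9 p. 54] -/
theorem exists_lt_doubleCoset_mk_layerSubgroup_eq (S : Subgroup (absoluteGaloisGroup K)) (hS : IsClosed (S : Set (absoluteGaloisGroup K)))
    {τ₁ : absoluteGaloisGroup K} (hτ₁ : τ₁ ∈ S) (hne : κ τ₁ ≠ 1) {γ : absoluteGaloisGroup K} (hγ : κ.IsTopGenerator γ)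
    (n : ℕ) (σ : absoluteGaloisGroup K) :
    ∃ a < p ^ ((κ τ₁).toAdd).valuation,
      DoubleCoset.mk S (κ.layerSubgroup n) σ = DoubleCoset.mk S (κ.layerSubgroup n) (γ ^ a) := by
  obtain ⟨a, ha, h⟩ := exists_lt_doubleCoset_mk_eq' κ S hS hτ₁ hne hγ σ
  exact ⟨a, ha, doubleCoset_mk_eq_of_le S κ.kerSubgroup (κ.layerSubgroup n) (κ.kerSubgroup_le_layerSubgroup n) h⟩

/-- **`a ↦ S·γ^a·Γ_n` maps `{a < p^m}` ONTO `S \ Γ_K / Γ_n` at every layer `n`.** [cite: NeukirchANT1999, Ch. I §9 p. 54] -/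
theorem doubleCoset_mk_pow_layerSubgroup_surjective (S : Subgroup (absoluteGaloisGroup K)) (hS : IsClosed (S : Set (absoluteGaloisGroup K)))
    {τ₁ : absoluteGaloisGroup K} (hτ₁ : τ₁ ∈ S) (hne : κ τ₁ ≠ 1) {γ : absoluteGaloisGroup K} (hγ : κ.IsTopGenerator γ) (n : ℕ) :
    Function.Surjective (fun a : Fin (p ^ ((κ τ₁).toAdd).valuation) ↦
      (DoubleCoset.mk S (κ.layerSubgroup n) (γ ^ (a : ℕ)) :
        DoubleCoset.Quotient (S : Set (absoluteGaloisGroup K)) (κ.layerSubgroup n))) := by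
  intro q
  induction q using Quotient.inductionOn' with
  | h σ =>
    obtain ⟨a, ha, hq⟩ := exists_lt_doubleCoset_mk_layerSubgroup_eq κ S hS hτ₁ hne hγ n σ
    exact ⟨⟨a, ha⟩, hq.symm⟩

/-- **`S \ Γ_K / Γ_n` is FINITE at every layer** (closed `S` on which `κ` is non-trivial): finitely many places of `K_n` above `w`.
[cite: NeukirchANT1999, Ch. I §9 p. 54] -/
theorem finite_doubleCosetQuotient_layerSubgroup (S : Subgroup (absoluteGaloisGroup K)) (hS : IsClosed (S : Set (absoluteGaloisGroup K)))
    {τ₁ : absoluteGaloisGroup K} (hτ₁ : τ₁ ∈ S) (hne : κ τ₁ ≠ 1) (n : ℕ) :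
    Finite (DoubleCoset.Quotient (S : Set (absoluteGaloisGroup K)) (κ.layerSubgroup n)) := by
  obtain ⟨γ, hγ⟩ := κ.surjective (Multiplicative.ofAdd 1)
  exact Finite.of_surjective _ (doubleCoset_mk_pow_layerSubgroup_surjective κ S hS hτ₁ hne hγ n)

/-- **`#(S \ Γ_K / Γ_n) ≤ p^m` at every layer.** [cite: NeukirchANT1999, Ch. I §9 p. 54] -/
theorem natCard_doubleCosetQuotient_layerSubgroup_le (S : Subgroup (absoluteGaloisGroup K)) (hS : IsClosed (S : Set (absoluteGaloisGroup K)))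
    {τ₁ : absoluteGaloisGroup K} (hτ₁ : τ₁ ∈ S) (hne : κ τ₁ ≠ 1) (n : ℕ) :
    Nat.card (DoubleCoset.Quotient (S : Set (absoluteGaloisGroup K)) (κ.layerSubgroup n)) ≤ p ^ ((κ τ₁).toAdd).valuation := by
  obtain ⟨γ, hγ⟩ := κ.surjective (Multiplicative.ofAdd 1)
  simpa only [Nat.card_eq_fintype_card, Fintype.card_fin] using
    Nat.card_le_card_of_surjective _ (doubleCoset_mk_pow_layerSubgroup_surjective κ S hS hτ₁ hne hγ n)

/-- **`#(S \ Γ_K / Γ_n) = p^m = #(S \ Γ_K / ker κ)` for `n ≥ m`**: the count of places above `w` is constant from layer `m` on and equals the count over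
`K_∞`. [cite: Washington1997, §13.2] [cite: NeukirchANT1999, Ch. I §9 p. 54] -/
theorem natCard_doubleCosetQuotient_layerSubgroup_eq_of_le (S : Subgroup (absoluteGaloisGroup K))
    (hS : IsClosed (S : Set (absoluteGaloisGroup K))) {τ₁ : absoluteGaloisGroup K} (hτ₁ : τ₁ ∈ S) (hne : κ τ₁ ≠ 1)
    (hmin : ∀ τ ∈ S, (p : ℤ_[p]) ^ ((κ τ₁).toAdd).valuation ∣ (κ τ).toAdd) {n : ℕ} (hn : ((κ τ₁).toAdd).valuation ≤ n) :
    Nat.card (DoubleCoset.Quotient (S : Set (absoluteGaloisGroup K)) (κ.layerSubgroup n)) = p ^ ((κ τ₁).toAdd).valuation := by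
  obtain ⟨γ, hγ⟩ := κ.surjective (Multiplicative.ofAdd 1)
  have hinj : Function.Injective (fun a : Fin (p ^ ((κ τ₁).toAdd).valuation) ↦
      (DoubleCoset.mk S (κ.layerSubgroup n) (γ ^ (a : ℕ)) :
        DoubleCoset.Quotient (S : Set (absoluteGaloisGroup K)) (κ.layerSubgroup n))) := by
    intro a b hab
    exact doubleCoset_mk_pow_injective' κ S hmin hγ
      ((doubleCoset_mk_layerSubgroup_eq_iff_mk_kerSubgroup_eq κ S hS hτ₁ hne hmin hn _ _).mp hab)
  rw [← Nat.card_eq_of_bijective _ ⟨hinj, doubleCoset_mk_pow_layerSubgroup_surjective κ S hS hτ₁ hne hγ n⟩,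
    Nat.card_eq_fintype_card, Fintype.card_fin]

end Counts

/-! ## §3. `S = D_w` on the line / on a frame -/

section Line

variable {K : Type} [Field K] [NumberField K]

/-- **On the `v̄`-line over an imaginary quadratic `K` with `p = v v̄`, every layer `K_n` has finitely many places above every `w ≠ v̄`, at most
`p^{m_w}` of them** (`W`-free). [cite: NeukirchANT1999, Ch. I §9 p. 54] [cite: Washington1997, §13.1] -/
theorem finite_doubleCosetQuotient_decomp_layerSubgroup_of_line {p : ℕ} [Fact p.Prime] (hK : IsImaginaryQuadratic K)
    {v vbar : HeightOneSpectrum (𝓞 K)} (hv : ((p : ℕ) : 𝓞 K) ∈ v.asIdeal) (hvbar : ((p : ℕ) : 𝓞 K) ∈ vbar.asIdeal) (hne : vbar ≠ v)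
    (κ : ZpExtension K p) (hκ : κ.IsUnramifiedOutside vbar) {w : HeightOneSpectrum (𝓞 K)} (hw : w ≠ vbar) (n : ℕ) :
    Finite (DoubleCoset.Quotient (GreenbergSelmer.decomp w : Set (absoluteGaloisGroup K)) (κ.layerSubgroup n)) := by
  obtain ⟨τ₁, hτ₁, hnot⟩ := SetLike.not_le_iff_exists.mp
    (LineDecomposition.decomp_not_le_kerSubgroup_of_isUnramifiedOutside hK hv hvbar hne κ hκ hw)
  exact finite_doubleCosetQuotient_layerSubgroup κ (GreenbergSelmer.decomp w) (isClosed_decomp w) hτ₁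
    (fun h ↦ hnot (by rwa [ZpExtension.mem_kerSubgroup])) n

/-- **On a road-α frame, every layer `K*_n` has finitely many places above EVERY place `w` of `K`.** [cite: NeukirchANT1999, Ch. I §9 p. 54] -/
theorem finite_doubleCosetQuotient_decomp_layerSubgroup_of_frame {d : ℤ} (hd0 : d ≠ 0) (W : WeierstrassCurve ℚ) [W.IsElliptic]
    (C : VariableChange ℚ) (hC : C • W = cm7.quadraticTwist (d : ℚ)) (hK : IsImaginaryQuadratic K)
    {v vbar : HeightOneSpectrum (𝓞 K)} (hv : ((2 : ℕ) : 𝓞 K) ∈ v.asIdeal) (hvbar : ((2 : ℕ) : 𝓞 K) ∈ vbar.asIdeal) (hne : vbar ≠ v)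
    (π : (W.baseChange K).endRing) (hrel : (π : AddMonoid.End (W.baseChange K).geomPoints) * π = π - 2)
    (κ' : ZpExtension K 2) (hκ' : κ'.IsUnramifiedOutside vbar) (w : HeightOneSpectrum (𝓞 K)) (n : ℕ) :
    Finite (DoubleCoset.Quotient (GreenbergSelmer.decomp w : Set (absoluteGaloisGroup K)) (κ'.layerSubgroup n)) := by
  haveI : Fact (Nat.Prime 2) := ⟨Nat.prime_two⟩
  by_cases hw : w = vbar
  · subst hw
    obtain ⟨τ₁, hτ₁, hu⟩ := exists_mem_inertia_isUnit_of_frame hd0 W C hC hK hv hvbar hne π hrel κ' hκ'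
    have hne1 : κ' τ₁ ≠ 1 := fun h ↦ by
      rw [h, toAdd_one] at hu
      exact not_isUnit_zero hu
    exact finite_doubleCosetQuotient_layerSubgroup κ' (GreenbergSelmer.decomp w) (isClosed_decomp w)
      (GreenbergSelmer.inertia_le_decomp w hτ₁) hne1 n
  · exact finite_doubleCosetQuotient_decomp_layerSubgroup_of_line hK hv hvbar hne κ' hκ' hw n

end Line

/-! ## §4. UNIFORM STABILISATION over a finite set of places `T` — «separation of the `ker κ`-double cosets at a deep layer» -/

section Uniform

variable {K : Type} [Field K] [NumberField K] {p : ℕ} [Fact p.Prime] (κ : ZpExtension K p)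

/-- **Uniform stabilisation.** For a FINITE set `T` of places of `K` none of which splits completely in `K_∞` (`D_w ⊄ ker κ`), there is a layer
`N` such that for every `n ≥ N` and every `w ∈ T`: `D_w·σ·Γ_n = D_w·σ'·Γ_n ↔ D_w·σ·ker κ = D_w·σ'·ker κ` — distinct places of `K_∞` above the
`T`-places are already distinct in `K_n` (take `N ≥ m_w` for all `w ∈ T`). The «compactness separation at a deep layer» of the limit step
(SUR*_n) ∀ n ⟹ (LS↑), with an explicit `N`. [cite: Washington1997, §13.2] [cite: NeukirchANT1999, Ch. I §9 p. 54] -/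
theorem exists_forall_doubleCoset_mk_layerSubgroup_eq_iff (T : Finset (HeightOneSpectrum (𝓞 K)))
    (hT : ∀ w ∈ T, ¬ GreenbergSelmer.decomp w ≤ κ.kerSubgroup) :
    ∃ N : ℕ, ∀ n, N ≤ n → ∀ w ∈ T, ∀ σ σ' : absoluteGaloisGroup K,
      DoubleCoset.mk (GreenbergSelmer.decomp w) (κ.layerSubgroup n) σ =
          DoubleCoset.mk (GreenbergSelmer.decomp w) (κ.layerSubgroup n) σ' ↔
        DoubleCoset.mk (GreenbergSelmer.decomp w) κ.kerSubgroup σ = DoubleCoset.mk (GreenbergSelmer.decomp w) κ.kerSubgroup σ' := by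
  classical
  -- a minimal-valuation witness at each `w ∈ T`
  have hw : ∀ w ∈ T, ∃ τ₁ ∈ GreenbergSelmer.decomp w, κ τ₁ ≠ 1 ∧
      ∀ τ ∈ GreenbergSelmer.decomp w, (p : ℤ_[p]) ^ ((κ τ₁).toAdd).valuation ∣ (κ τ).toAdd := by
    intro w hwT
    obtain ⟨τ₀, hτ₀, hnot⟩ := SetLike.not_le_iff_exists.mp (hT w hwT)
    exact exists_mem_minimal_valuation κ (GreenbergSelmer.decomp w) hτ₀ (fun h ↦ hnot (by rwa [ZpExtension.mem_kerSubgroup]))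
  choose! τ₁ hτ₁ hne hmin using hw
  refine ⟨T.sup fun w ↦ ((κ (τ₁ w)).toAdd).valuation, fun n hn w hwT σ σ' ↦ ?_⟩
  have hle : ((κ (τ₁ w)).toAdd).valuation ≤ n :=
    (Finset.le_sup (f := fun w ↦ ((κ (τ₁ w)).toAdd).valuation) hwT).trans hn
  exact doubleCoset_mk_layerSubgroup_eq_iff_mk_kerSubgroup_eq κ (GreenbergSelmer.decomp w) (isClosed_decomp w)
    (hτ₁ w hwT) (hne w hwT) (hmin w hwT) hle σ σ'

/-- **Uniform stabilisation, counted**: with `N` as above, for `n ≥ N` and `w ∈ T` the layer `K_n` and `K_∞` have the SAME number of places above `w`.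
[cite: Washington1997, §13.2] -/
theorem exists_forall_natCard_doubleCosetQuotient_layerSubgroup_eq (T : Finset (HeightOneSpectrum (𝓞 K)))
    (hT : ∀ w ∈ T, ¬ GreenbergSelmer.decomp w ≤ κ.kerSubgroup) :
    ∃ N : ℕ, ∀ n, N ≤ n → ∀ w ∈ T,
      Nat.card (DoubleCoset.Quotient (GreenbergSelmer.decomp w : Set (absoluteGaloisGroup K)) (κ.layerSubgroup n)) =
        Nat.card (DoubleCoset.Quotient (GreenbergSelmer.decomp w : Set (absoluteGaloisGroup K)) κ.kerSubgroup) := by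
  classical
  have hw : ∀ w ∈ T, ∃ τ₁ ∈ GreenbergSelmer.decomp w, κ τ₁ ≠ 1 ∧
      ∀ τ ∈ GreenbergSelmer.decomp w, (p : ℤ_[p]) ^ ((κ τ₁).toAdd).valuation ∣ (κ τ).toAdd := by
    intro w hwT
    obtain ⟨τ₀, hτ₀, hnot⟩ := SetLike.not_le_iff_exists.mp (hT w hwT)
    exact exists_mem_minimal_valuation κ (GreenbergSelmer.decomp w) hτ₀ (fun h ↦ hnot (by rwa [ZpExtension.mem_kerSubgroup]))
  choose! τ₁ hτ₁ hne hmin using hw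
  refine ⟨T.sup fun w ↦ ((κ (τ₁ w)).toAdd).valuation, fun n hn w hwT ↦ ?_⟩
  have hle : ((κ (τ₁ w)).toAdd).valuation ≤ n :=
    (Finset.le_sup (f := fun w ↦ ((κ (τ₁ w)).toAdd).valuation) hwT).trans hn
  rw [natCard_doubleCosetQuotient_layerSubgroup_eq_of_le κ (GreenbergSelmer.decomp w) (isClosed_decomp w) (hτ₁ w hwT)
      (hne w hwT) (hmin w hwT) hle,
    natCard_doubleCosetQuotient_eq' κ (GreenbergSelmer.decomp w) (isClosed_decomp w) (hτ₁ w hwT) (hne w hwT) (hmin w hwT)]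

end Uniform

section UniformLine

variable {K : Type} [Field K] [NumberField K]

/-- **Uniform stabilisation on the `v̄`-line** (`κ` unramified outside `v̄`, `K` imaginary quadratic, `p = v v̄`), for any finite `T ∌ v̄` — `W`-free:
beyond some layer `N`, the places above the `T`-places do not split further. [cite: Washington1997, §13.2] [cite: deShalit1987, II §1.9] -/
theorem exists_forall_doubleCoset_mk_layerSubgroup_eq_iff_of_line {p : ℕ} [Fact p.Prime] (hK : IsImaginaryQuadratic K)
    {v vbar : HeightOneSpectrum (𝓞 K)} (hv : ((p : ℕ) : 𝓞 K) ∈ v.asIdeal) (hvbar : ((p : ℕ) : 𝓞 K) ∈ vbar.asIdeal) (hne : vbar ≠ v)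
    (κ : ZpExtension K p) (hκ : κ.IsUnramifiedOutside vbar) (T : Finset (HeightOneSpectrum (𝓞 K))) (hT : vbar ∉ T) :
    ∃ N : ℕ, ∀ n, N ≤ n → ∀ w ∈ T, ∀ σ σ' : absoluteGaloisGroup K,
      DoubleCoset.mk (GreenbergSelmer.decomp w) (κ.layerSubgroup n) σ =
          DoubleCoset.mk (GreenbergSelmer.decomp w) (κ.layerSubgroup n) σ' ↔
        DoubleCoset.mk (GreenbergSelmer.decomp w) κ.kerSubgroup σ = DoubleCoset.mk (GreenbergSelmer.decomp w) κ.kerSubgroup σ' :=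
  exists_forall_doubleCoset_mk_layerSubgroup_eq_iff κ T fun _ hw ↦
    LineDecomposition.decomp_not_le_kerSubgroup_of_isUnramifiedOutside hK hv hvbar hne κ hκ (fun h ↦ hT (h ▸ hw))

/-- **Uniform stabilisation on a road-α frame, for EVERY finite `T`** (at `v̄` the line is totally ramified, part 2). [cite: Washington1997, §13.2] -/
theorem exists_forall_doubleCoset_mk_layerSubgroup_eq_iff_of_frame {d : ℤ} (hd0 : d ≠ 0) (W : WeierstrassCurve ℚ) [W.IsElliptic]
    (C : VariableChange ℚ) (hC : C • W = cm7.quadraticTwist (d : ℚ)) (hK : IsImaginaryQuadratic K)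
    {v vbar : HeightOneSpectrum (𝓞 K)} (hv : ((2 : ℕ) : 𝓞 K) ∈ v.asIdeal) (hvbar : ((2 : ℕ) : 𝓞 K) ∈ vbar.asIdeal) (hne : vbar ≠ v)
    (π : (W.baseChange K).endRing) (hrel : (π : AddMonoid.End (W.baseChange K).geomPoints) * π = π - 2)
    (κ' : ZpExtension K 2) (hκ' : κ'.IsUnramifiedOutside vbar) (T : Finset (HeightOneSpectrum (𝓞 K))) :
    ∃ N : ℕ, ∀ n, N ≤ n → ∀ w ∈ T, ∀ σ σ' : absoluteGaloisGroup K,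
      DoubleCoset.mk (GreenbergSelmer.decomp w) (κ'.layerSubgroup n) σ =
          DoubleCoset.mk (GreenbergSelmer.decomp w) (κ'.layerSubgroup n) σ' ↔
        DoubleCoset.mk (GreenbergSelmer.decomp w) κ'.kerSubgroup σ = DoubleCoset.mk (GreenbergSelmer.decomp w) κ'.kerSubgroup σ' := by
  haveI : Fact (Nat.Prime 2) := ⟨Nat.prime_two⟩
  refine exists_forall_doubleCoset_mk_layerSubgroup_eq_iff κ' T fun w _ ↦ ?_
  by_cases hw : w = vbar
  · subst hw
    obtain ⟨τ₁, hτ₁, hu⟩ := exists_mem_inertia_isUnit_of_frame hd0 W C hC hK hv hvbar hne π hrel κ' hκ'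
    have hne1 : κ' τ₁ ≠ 1 := fun h ↦ by
      rw [h, toAdd_one] at hu
      exact not_isUnit_zero hu
    exact fun hle ↦ hne1 (ZpExtension.mem_kerSubgroup.mp (hle (GreenbergSelmer.inertia_le_decomp w hτ₁)))
  · exact LineDecomposition.decomp_not_le_kerSubgroup_of_isUnramifiedOutside hK hv hvbar hne κ' hκ' hw

end UniformLine

section UniformLineAll

variable {K : Type} [Field K] [NumberField K]

/-- **Uniform stabilisation on the `v̄`-line for EVERY finite `T` (also `T ∋ v̄`), `W`-free**: no place of `K` splits completely in the line
(part 4b `decomp_not_le_kerSubgroup_of_isUnramifiedOutside'`), so beyond some layer `N` no place above a `T`-place splits further.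
[cite: Washington1997, §13.2] [cite: deShalit1987, Ch. II §1.1] -/
theorem exists_forall_doubleCoset_mk_layerSubgroup_eq_iff_of_line_all {p : ℕ} [Fact p.Prime] (hK : IsImaginaryQuadratic K)
    {v vbar : HeightOneSpectrum (𝓞 K)} (hv : ((p : ℕ) : 𝓞 K) ∈ v.asIdeal) (hvbar : ((p : ℕ) : 𝓞 K) ∈ vbar.asIdeal) (hne : vbar ≠ v)
    (κ : ZpExtension K p) (hκ : κ.IsUnramifiedOutside vbar) (T : Finset (HeightOneSpectrum (𝓞 K))) :
    ∃ N : ℕ, ∀ n, N ≤ n → ∀ w ∈ T, ∀ σ σ' : absoluteGaloisGroup K,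
      DoubleCoset.mk (GreenbergSelmer.decomp w) (κ.layerSubgroup n) σ =
          DoubleCoset.mk (GreenbergSelmer.decomp w) (κ.layerSubgroup n) σ' ↔
        DoubleCoset.mk (GreenbergSelmer.decomp w) κ.kerSubgroup σ = DoubleCoset.mk (GreenbergSelmer.decomp w) κ.kerSubgroup σ' :=
  exists_forall_doubleCoset_mk_layerSubgroup_eq_iff κ T fun w _ ↦
    decomp_not_le_kerSubgroup_of_isUnramifiedOutside' hK hv hvbar hne κ hκ w

/-- **`W`-free: every layer `K_n` of the `v̄`-line has finitely many places above EVERY place `w` of `K`** (also `w = v̄`).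
[cite: NeukirchANT1999, Ch. I §9 p. 54] -/
theorem finite_doubleCosetQuotient_decomp_layerSubgroup_of_line_all {p : ℕ} [Fact p.Prime] (hK : IsImaginaryQuadratic K)
    {v vbar : HeightOneSpectrum (𝓞 K)} (hv : ((p : ℕ) : 𝓞 K) ∈ v.asIdeal) (hvbar : ((p : ℕ) : 𝓞 K) ∈ vbar.asIdeal) (hne : vbar ≠ v)
    (κ : ZpExtension K p) (hκ : κ.IsUnramifiedOutside vbar) (w : HeightOneSpectrum (𝓞 K)) (n : ℕ) :
    Finite (DoubleCoset.Quotient (GreenbergSelmer.decomp w : Set (absoluteGaloisGroup K)) (κ.layerSubgroup n)) := by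
  obtain ⟨τ₁, hτ₁, hnot⟩ := SetLike.not_le_iff_exists.mp (decomp_not_le_kerSubgroup_of_isUnramifiedOutside' hK hv hvbar hne κ hκ w)
  exact finite_doubleCosetQuotient_layerSubgroup κ (GreenbergSelmer.decomp w) (isClosed_decomp w) hτ₁
    (fun h ↦ hnot (by rwa [ZpExtension.mem_kerSubgroup])) n

end UniformLineAll

end Summit.BirchSwinnertonDyer.BirchSwinnertonDyer.Theorems.PrintCf2.LineDoubleCoset

end
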